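import Summits.BirchSwinnertonDyer.Rank1Residual.Additive.StrictSignedLocalPreimageCard
import Summits.BirchSwinnertonDyer.Rank1Residual.Additive.LocalTowerKernelCardEqTamagawaCyclotomic
import Summits.BirchSwinnertonDyer.Rank1Residual.Additive.StrictSelmerDominatesSha
import Literature.NumberTheory.EllipticCurves.SubgroupSelmerProofs
import Literature.NumberTheory.EllipticCurves.BSDConductorProofs
import HarnessLib

/-!
# The DEFECT of the bottom-layer control, bounded by the local receptacles AWAY from `p`:
# `#(Sel^{loc,∞}(W/ℚ) ⧸ Sel^{ε,str}(W/ℚ_0)) ∣ ∏_{ℓ ∈ S, ℓ ≠ p} #𝒦_{ℓ,0}[p^∞] = ∏ p^{ord_p c_ℓ(W)}`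
# GIVEN that the level-`∞` signed condition pulls back to the level-`0` one at `p`
# (cell `bsd-potss`, seat `bsd-potss-ctrl` g2; file 4 of the T-e2-r0 series — files 1–2 = p401824,
# p401865; for `ε = +1` the hypothesis is Kobayashi's (9.33), for `ε = −1` it FAILS in rank one, where
# x1b's count (C) replaces it)

HONEST FRAMING (cell `bsd-potss`, run/shared/lean/pub/bsd-potss/; FULL-BSD rank ≤ 1 programme,
tranche 1b): TOOL THEOREMS ONLY — no definition, no named Literature fact, no Summits-side fact
`def … : Prop`, no `sorry`, axioms standard. The local input at `p` (`hloc`: every class of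
`Sel^{loc,∞}` satisfies the level-`0` signed Kummer condition at `ℚ_[p]`) is a DISPLAYED HYPOTHESIS —
for `ε = +1` it is the `W`-coordinate form of Kobayashi's (9.33) at `n = 0` ("For `v | p`, the kernel
of `r_v` is zero by (9.33)", proof of Thm. 9.3, p. 27), a READING of a printed theorem whose kernel
proof is this seat's sequel; nothing is booked; no label / mark / count moves; nothing about (C1_η)
or `BSD(W, p)` of any pair is claimed.

## What

Notation: `W/ℚ` elliptic, `p` prime, `κ` a `ℤ_p`-extension of `ℚ`, model `ℚ_[p]` at `p`, sign `ε`;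
`A₀ = Sel^{loc,∞}(W/ℚ)` = the classes over `ℚ` whose restriction to `ℚ_∞` lies in `Sel_{p^∞}(W/ℚ_∞)`
and in the level-`∞` signed Kummer condition at every conjugate of `closureEmb ℚ_[p]` (x1b's B2
group); `S₀ = Sel^{ε,str}(W/ℚ_0)`; `S ⊇ {(p)} ∪ {bad}` finite; `𝒦_{v,0}[p^∞] =
W.localTowerKerPrimary κ ℚ_v 0` (Greenberg's `ker r_v`).

* §1 `localKerOver_padic_iff_adicCompletion` — the classical local kernel at the MODEL `ℚ_[p]` is the
  classical local kernel at the COMPLETION `ℚ_v`, `v = (p)` (transport along Mathlib's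
  `Padic.adicCompletionEquiv`, both directions of `localRestrictionKer_le_of_tower`).
* §2 **`natCard_quotient_dvd_prod_natCard_localTowerKerPrimary_of_loc`**: given `hloc`,
  `#(A₀ ⧸ S₀) ∣ ∏_{v ∈ S, p ∉ v} #𝒦_{v,0}[p^∞]` — the localisation `A₀ → ∏_{v ∈ S, v ∤ p} 𝒦_{v,0}[p^∞]`
  (`localResOver_mem_localTowerKer_zero`; `p`-primary because `A₀` is) KILLS EXACTLY… contains `S₀` in
  its kernel and its kernel lies in `S₀` (x1b's B2 criterion
  `mem_strictSignedSelmerLayer_zero_iff_of_layerToInfty_mem`: `y ∈ S₀` iff `loc_v y = 0` for `v ∈ S`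
  and `y` is level-`0` signed-Kummer at `ℚ_[p]`; at `v = (p)` both follow from `hloc` — the Kummer
  condition refines the classical one, `localKummerOverOfEmb_le_localKerOverOfEmb`, and §1).
* §3 `prod_natCard_localTowerKerPrimary_eq_prod_pow` — for `κ` cyclotomic,
  `∏_{v ∈ S, p ∉ v} #𝒦_{v,0}[p^∞] = ∏ p^{ord_p c_v(W)}` (B4, x1b file 54 / Greenberg Lemma 3.3), hence
  **`ord_p #(A₀ ⧸ S₀) ≤ ∑_{v ∈ S, p ∉ v} ord_p c_v(W)`** (`padicValNat_card_quotient_le_sum_of_loc`).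

What is NOT here: the EXACTNESS `#(A₀ ⧸ S₀) = ∏ p^{ord_p c_v}` (surjectivity of the localisation
onto the receptacles — Cassels–Poitou–Tate in rank zero, a sequel), and the discharge of `hloc` for
`ε = +1` (Kobayashi (9.33)).

References: [GreenbergLNM1716] R. Greenberg, LNM 1716 (1999), §3 Lemma 3.3 (pp. 86–88), p. 90, §4
Thm. 4.1; [Kobayashi2003] S. Kobayashi, Invent. Math. 152 (2003), Def. 2.1 (p. 5), Prop. 9.2,
Thm. 9.3 with (9.33) (pp. 25–27); [SerreGaloisCohomology1997] I.§2.4, II.§1.1 (independence of the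
model of the completion).
-/

noncomputable section

open scoped Classical

open Field Function NumberField IsDedekindDomain WeierstrassCurve
open Literature.NumberTheory Literature.NumberTheory.EllipticCurves
  Literature.NumberTheory.GaloisRepresentations
  Literature.NumberTheory.EllipticCurves.IwasawaAlgebra Literature.NumberTheory.EllipticCurves.IwasawaDual
  Literature.NumberTheory.EllipticCurves.Kobayashi2003 ZpExtension

namespace Summit.BirchSwinnertonDyer.Rank1Residual.Additive

namespace StrictSignedControlZero

/-! ## §1 The local kernel at the model `ℚ_[p]` is the local kernel at the completion `ℚ_{(p)}` -/

section Model

variable (W : WeierstrassCurve ℚ) (p : ℕ) [hp : Fact p.Prime]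

/-- **`selmerLocalKerPrimary W ℚ_[p] p = selmerLocalKerPrimary W ℚ_v p`**, `v = (p)`: the local kernel
of `H¹(ℚ, W[p^∞]) → H¹(·, W)` does not depend on the model of the completion — both are preimages of the
`H¹(·, W)`-kernels (`selmerLocalKerPrimary_eq_comap`), which grow along `ℚ`-algebra maps
(`localRestrictionKer_le_of_tower`), and Mathlib's `Padic.adicCompletionEquiv` maps both ways.
[cite: SerreGaloisCohomology1997, I.§2.4 and II.§1.1] -/
theorem selmerLocalKerPrimary_padic_eq_adicCompletion :
    selmerLocalKerPrimary W ℚ_[p] p =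
      selmerLocalKerPrimary W
        (((Rat.HeightOneSpectrum.primesEquiv (R := 𝓞 ℚ)).symm ⟨p, hp.out⟩).adicCompletion ℚ) p := by
  set v : HeightOneSpectrum (𝓞 ℚ) :=
    (Rat.HeightOneSpectrum.primesEquiv (R := 𝓞 ℚ)).symm ⟨p, hp.out⟩ with hv
  let e : ℚ_[p] ≃A[ℚ] v.adicCompletion ℚ := Padic.adicCompletionEquiv (𝓞 ℚ) ⟨p, hp.out⟩
  apply le_antisymm
  · -- `ℚ_[p] → ℚ_v`
    letI : Algebra ℚ_[p] (v.adicCompletion ℚ) :=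
      ((e : ℚ_[p] ≃A[ℚ] v.adicCompletion ℚ) : ℚ_[p] →ₐ[ℚ] v.adicCompletion ℚ).toRingHom.toAlgebra
    haveI : IsScalarTower ℚ ℚ_[p] (v.adicCompletion ℚ) :=
      IsScalarTower.of_algebraMap_eq fun q ↦
        (((e : ℚ_[p] ≃A[ℚ] v.adicCompletion ℚ) : ℚ_[p] →ₐ[ℚ] v.adicCompletion ℚ).commutes q).symm
    intro c hc
    rw [selmerLocalKerPrimary_eq_comap, AddSubgroup.mem_comap] at hc ⊢
    exact localRestrictionKer_le_of_tower W (E := ℚ_[p]) hc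
  · -- `ℚ_v → ℚ_[p]`
    letI : Algebra (v.adicCompletion ℚ) ℚ_[p] :=
      ((e.symm : v.adicCompletion ℚ ≃A[ℚ] ℚ_[p]) : v.adicCompletion ℚ →ₐ[ℚ] ℚ_[p]).toRingHom.toAlgebra
    haveI : IsScalarTower ℚ (v.adicCompletion ℚ) ℚ_[p] :=
      IsScalarTower.of_algebraMap_eq fun q ↦
        (((e.symm : v.adicCompletion ℚ ≃A[ℚ] ℚ_[p]) : v.adicCompletion ℚ →ₐ[ℚ] ℚ_[p]).commutes q).symm
    intro c hc
    rw [selmerLocalKerPrimary_eq_comap, AddSubgroup.mem_comap] at hc ⊢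
    exact localRestrictionKer_le_of_tower W (E := v.adicCompletion ℚ) hc

/-- **The classical local kernel over `H = ⊤` at the model `ℚ_[p]` is the one at `ℚ_{(p)}`.** For a
class `y ∈ H¹(H, W[p^∞])`, `H = ⊤ = κ⁻¹(p⁰ℤ_p)`: `y ∈ localKerOver p H ℚ_[p] ↔ y ∈ localKerOver p H ℚ_v`,
`v = (p)` — transport along the bijective restriction `res : H¹(Γ_ℚ, ·) → H¹(⊤, ·)`
(`resH1Hom_subgroupIncl_mem_localKerOver_top_iff`) and `selmerLocalKerPrimary_padic_eq_adicCompletion`.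
[cite: SerreGaloisCohomology1997, I.§2.4 and II.§1.1] [cite: GreenbergLNM1716, §2] -/
theorem mem_localKerOver_padic_iff_adicCompletion (H : Subgroup (Field.absoluteGaloisGroup ℚ))
    (hH : H = ⊤) (y : W.subgroupH1 p H) :
    y ∈ W.localKerOver p H ℚ_[p] ↔
      y ∈ W.localKerOver p H
        (((Rat.HeightOneSpectrum.primesEquiv (R := 𝓞 ℚ)).symm ⟨p, hp.out⟩).adicCompletion ℚ) := by
  subst hH
  obtain ⟨c, rfl⟩ := (bijective_resH1Hom_subgroupIncl (W.geomPrimaryTorsion p)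
    (⊤ : Subgroup (Field.absoluteGaloisGroup ℚ)) Subgroup.mem_top).2 y
  rw [W.resH1Hom_subgroupIncl_mem_localKerOver_top_iff p c,
    W.resH1Hom_subgroupIncl_mem_localKerOver_top_iff p c,
    selmerLocalKerPrimary_padic_eq_adicCompletion W p]

end Model

/-! ## §2 The defect embeds into the receptacles away from `p` -/

section Defect

variable (W : WeierstrassCurve ℚ) [W.IsElliptic] {p : ℕ} [hp : Fact p.Prime] (κ : ZpExtension ℚ p)
  (ε : ℤˣ)

/-- **`#(Sel^{loc,∞}(W/ℚ) ⧸ Sel^{ε,str}(W/ℚ_0)) ∣ ∏_{v ∈ S, p ∉ v} #𝒦_{v,0}[p^∞]` GIVEN `hloc`.** For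
`W/ℚ` elliptic, a `ℤ_p`-extension `κ`, a sign `ε`, a finite `S` off which `W` is good and `v ∤ p`, and
`A₀ = Sel^{loc,∞}(W/ℚ)` FINITE: IF every `y ∈ A₀` satisfies the LEVEL-`0` signed Kummer condition at
`ℚ_[p]` (`hloc`; for `ε = +1` Kobayashi's (9.33) at `n = 0`), THEN the order of `A₀ ⧸ S₀` divides the
product over `v ∈ S`, `v ∤ p`, of the orders of the local receptacles `𝒦_{v,0}[p^∞]` (Greenberg's
`ker r_v`). Proof: the localisation `Φ : A₀ → ∏_{v ∈ S, v ∤ p} 𝒦_{v,0}[p^∞]` is defined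
(`localResOver_mem_localTowerKer_zero`, `p`-primarity of `H¹(ℚ, W[p^∞])`), and `ker Φ ≤ S₀` by x1b's B2
criterion (`mem_strictSignedSelmerLayer_zero_iff_of_layerToInfty_mem`): at `v ∈ S`, `v ∤ p` by
`Φ y = 0`; at `v = (p)` and for the signed Kummer condition at `ℚ_[p]` by `hloc`
(`localKummerOverOfEmb_le_localKerOverOfEmb` + §1); so `#(A₀⧸S₀) ∣ #(A₀⧸ker Φ) = #range Φ ∣ #∏`.
[cite: GreenbergLNM1716, §3 Lemma 3.3 (pp. 86–88) and p. 90] [cite: Kobayashi2003, Thm. 9.3 with (9.33) (pp. 26–27)] -/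
theorem natCard_quotient_dvd_prod_natCard_localTowerKerPrimary_of_loc
    (S : Finset (HeightOneSpectrum (𝓞 ℚ)))
    (hS : ∀ v ∉ S, (p : 𝓞 ℚ) ∉ v.asIdeal ∧ W.HasGoodReductionAt v)
    (hloc : ∀ y ∈ (W.selmerInfty κ ⊓
          ⨅ σ : Field.absoluteGaloisGroup ℚ,
            (localKummerOverOfEmb W p κ.kerSubgroup (closureEmb (K := ℚ) ℚ_[p])
                (⨆ m, strictSignedLocalPoints κ ℚ_[p] W ε m)).comap (W.conjH1 p κ.kerSubgroup σ)).comap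
          (W.layerToInfty κ 0),
      y ∈ localKummerOverOfEmb W p (κ.layerSubgroup 0) (closureEmb (K := ℚ) ℚ_[p])
        (strictSignedLocalPoints κ ℚ_[p] W ε 0))
    [Finite (↥((W.selmerInfty κ ⊓
          ⨅ σ : Field.absoluteGaloisGroup ℚ,
            (localKummerOverOfEmb W p κ.kerSubgroup (closureEmb (K := ℚ) ℚ_[p])
                (⨆ m, strictSignedLocalPoints κ ℚ_[p] W ε m)).comap (W.conjH1 p κ.kerSubgroup σ)).comap
          (W.layerToInfty κ 0)))] :
    Nat.card (↥((W.selmerInfty κ ⊓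
          ⨅ σ : Field.absoluteGaloisGroup ℚ,
            (localKummerOverOfEmb W p κ.kerSubgroup (closureEmb (K := ℚ) ℚ_[p])
                (⨆ m, strictSignedLocalPoints κ ℚ_[p] W ε m)).comap (W.conjH1 p κ.kerSubgroup σ)).comap
          (W.layerToInfty κ 0)) ⧸
        (strictSignedSelmerLayer W κ ℚ_[p] ε 0).addSubgroupOf ((W.selmerInfty κ ⊓
          ⨅ σ : Field.absoluteGaloisGroup ℚ,
            (localKummerOverOfEmb W p κ.kerSubgroup (closureEmb (K := ℚ) ℚ_[p])
                (⨆ m, strictSignedLocalPoints κ ℚ_[p] W ε m)).comap (W.conjH1 p κ.kerSubgroup σ)).comap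
          (W.layerToInfty κ 0))) ∣
      ∏ v ∈ S.filter (fun v ↦ (p : 𝓞 ℚ) ∉ v.asIdeal),
        Nat.card (W.localTowerKerPrimary κ (v.adicCompletion ℚ) 0) := by
  set A := (W.selmerInfty κ ⊓
      ⨅ σ : Field.absoluteGaloisGroup ℚ,
        (localKummerOverOfEmb W p κ.kerSubgroup (closureEmb (K := ℚ) ℚ_[p])
            (⨆ m, strictSignedLocalPoints κ ℚ_[p] W ε m)).comap (W.conjH1 p κ.kerSubgroup σ)).comap
      (W.layerToInfty κ 0) with hA
  set S0 := strictSignedSelmerLayer W κ ℚ_[p] ε 0 with hS0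
  set S' := S.filter (fun v ↦ (p : 𝓞 ℚ) ∉ v.asIdeal) with hS'
  set v₀ : HeightOneSpectrum (𝓞 ℚ) :=
    (Rat.HeightOneSpectrum.primesEquiv (R := 𝓞 ℚ)).symm ⟨p, hp.out⟩ with hv₀
  -- every `y ∈ A` restricts into `Sel_{p^∞}(W/ℚ_∞)`
  have hsel : ∀ y : A, W.layerToInfty κ 0 (y : W.subgroupH1 p (κ.layerSubgroup 0)) ∈ W.selmerInfty κ :=
    fun y ↦ (AddSubgroup.mem_inf.mp (AddSubgroup.mem_comap.mp y.2)).1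
  -- the receptacle membership: `loc_v y ∈ 𝒦_{v,0}[p^∞]`
  have hmem : ∀ (y : A) (v : HeightOneSpectrum (𝓞 ℚ)),
      W.localResOver p (κ.layerSubgroup 0) (v.adicCompletion ℚ) (y : W.subgroupH1 p (κ.layerSubgroup 0)) ∈
        W.localTowerKerPrimary κ (v.adicCompletion ℚ) 0 := fun y v ↦ by
    refine (W.mem_localTowerKerPrimary_iff κ _ 0 _).mpr
      ⟨localResOver_mem_localTowerKer_zero W κ (hsel y) v, ?_⟩
    obtain ⟨k, hk⟩ := W.exists_pow_smul_subgroupH1_layer_eq_zero κ 0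
      (y : W.subgroupH1 p (κ.layerSubgroup 0))
    exact ⟨k, by rw [← map_nsmul, hk, map_zero]⟩
  -- the localisation away from `p`
  let Φ : A →+ ((v : S') → W.localTowerKerPrimary κ ((v : HeightOneSpectrum (𝓞 ℚ)).adicCompletion ℚ) 0) :=
    { toFun := fun y v ↦ ⟨W.localResOver p (κ.layerSubgroup 0) ((v : HeightOneSpectrum (𝓞 ℚ)).adicCompletion ℚ)
          (y : W.subgroupH1 p (κ.layerSubgroup 0)), hmem y v⟩
      map_zero' := by
        funext v
        exact Subtype.ext (by simp)
      map_add' := fun y z ↦ by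
        funext v
        exact Subtype.ext (by simp) }
  -- `ker Φ ≤ S₀`
  have hker : Φ.ker ≤ S0.addSubgroupOf A := by
    intro y hy
    rw [AddMonoidHom.mem_ker] at hy
    rw [AddSubgroup.mem_addSubgroupOf, hS0,
      mem_strictSignedSelmerLayer_zero_iff_of_layerToInfty_mem W κ ℚ_[p] ε S hS (hsel y)]
    have hlocy := hloc (y : W.subgroupH1 p (κ.layerSubgroup 0)) y.2
    refine ⟨fun v hv ↦ ?_, hlocy⟩
    by_cases hpv : (p : 𝓞 ℚ) ∈ v.asIdeal
    · -- `v = (p)`: the signed Kummer condition at `ℚ_[p]` refines the classical one, transported to `ℚ_v`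
      have hvv : v = v₀ := (natCast_mem_asIdeal_iff_eq_primesEquiv_symm v hp.out).mp hpv
      rw [hvv]
      have h1 : (y : W.subgroupH1 p (κ.layerSubgroup 0)) ∈
          W.localKerOver p (κ.layerSubgroup 0) ℚ_[p] := by
        rw [localKerOver_eq_ofEmb]
        exact localKummerOverOfEmb_le_localKerOverOfEmb _ hlocy
      exact (W.mem_localKerOver_iff p (κ.layerSubgroup 0) _ _).mp
        ((mem_localKerOver_padic_iff_adicCompletion W p (κ.layerSubgroup 0) κ.layerSubgroup_zero _).mp h1)
    · -- `v ∈ S`, `v ∤ p`: the `v`-component of `Φ y = 0`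
      have hvS' : v ∈ S' := Finset.mem_filter.mpr ⟨hv, hpv⟩
      have h := congrFun hy ⟨v, hvS'⟩
      exact congrArg Subtype.val h
  -- counting: `#(A⧸S₀) ∣ #(A⧸ker Φ) = #range Φ ∣ #∏`
  have h1 : Nat.card (A ⧸ S0.addSubgroupOf A) ∣ Nat.card (A ⧸ Φ.ker) :=
    AddSubgroup.index_dvd_of_le hker
  have h2 : Nat.card (A ⧸ Φ.ker) = Nat.card Φ.range := AddSubgroup.index_ker Φ
  have h3 : Nat.card Φ.range ∣
      Nat.card ((v : S') → W.localTowerKerPrimary κ ((v : HeightOneSpectrum (𝓞 ℚ)).adicCompletion ℚ) 0) :=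
    AddSubgroup.card_addSubgroup_dvd_card Φ.range
  rw [Nat.card_pi] at h3
  rw [← Finset.prod_coe_sort S']
  exact h1.trans (h2 ▸ h3)

end Defect

/-! ## §3 B4: the receptacles away from `p` have order `p^{ord_p c_v}` (cyclotomic `κ`) -/

section Tamagawa

variable (W : WeierstrassCurve ℚ) [W.IsElliptic] {p : ℕ} [hp : Fact p.Prime] {κ : ZpExtension ℚ p}

/-- **`∏_{v ∈ S, p ∉ v} #𝒦_{v,0}[p^∞] = ∏_{v ∈ S, p ∉ v} p^{ord_p c_v(W)}`** for the cyclotomic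
`ℤ_p`-extension (x1b file 54 = Greenberg's Lemma 3.3 "`|ker(r_v)| = c_v^{(p)}`", place by place).
[cite: GreenbergLNM1716, §3 Lemma 3.3 (pp. 86–88)] -/
theorem prod_natCard_localTowerKerPrimary_eq_prod_pow (hκ : κ.IsCyclotomic)
    (S : Finset (HeightOneSpectrum (𝓞 ℚ))) :
    ∏ v ∈ S.filter (fun v ↦ (p : 𝓞 ℚ) ∉ v.asIdeal),
        Nat.card (W.localTowerKerPrimary κ (v.adicCompletion ℚ) 0) =
      ∏ v ∈ S.filter (fun v ↦ (p : 𝓞 ℚ) ∉ v.asIdeal),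
        p ^ padicValNat p ((W.baseChange (v.adicCompletion ℚ)).localTamagawaNumber
          (v.adicCompletionIntegers ℚ)) :=
  Finset.prod_congr rfl fun _ hv ↦
    natCard_localTowerKerPrimary_zero_eq_pow_of_isCyclotomic W hκ (Finset.mem_filter.mp hv).2

variable (κ) (ε : ℤˣ)

/-- **`ord_p #(Sel^{loc,∞}(W/ℚ) ⧸ Sel^{ε,str}(W/ℚ_0)) ≤ ∑_{v ∈ S, p ∉ v} ord_p c_v(W)` GIVEN `hloc`**, for
the cyclotomic `ℤ_p`-extension: §2 and §3 (a divisor of `∏ p^{e_v} = p^{∑ e_v}` has `ord_p ≤ ∑ e_v`).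
For `ε = +1` (with `hloc` = Kobayashi's (9.33)) this is the Tamagawa side of the LOWER half of B. D.
Kim's formula on the `η`-branch; exactness (`=`) is the sequel.
[cite: GreenbergLNM1716, §3 Lemma 3.3 (pp. 86–88), §4 Thm. 4.1] [cite: Kobayashi2003, Thm. 9.3 with (9.33) (pp. 26–27)] -/
theorem padicValNat_card_quotient_le_sum_of_loc (hκ : κ.IsCyclotomic)
    (S : Finset (HeightOneSpectrum (𝓞 ℚ)))
    (hS : ∀ v ∉ S, (p : 𝓞 ℚ) ∉ v.asIdeal ∧ W.HasGoodReductionAt v)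
    (hloc : ∀ y ∈ (W.selmerInfty κ ⊓
          ⨅ σ : Field.absoluteGaloisGroup ℚ,
            (localKummerOverOfEmb W p κ.kerSubgroup (closureEmb (K := ℚ) ℚ_[p])
                (⨆ m, strictSignedLocalPoints κ ℚ_[p] W ε m)).comap (W.conjH1 p κ.kerSubgroup σ)).comap
          (W.layerToInfty κ 0),
      y ∈ localKummerOverOfEmb W p (κ.layerSubgroup 0) (closureEmb (K := ℚ) ℚ_[p])
        (strictSignedLocalPoints κ ℚ_[p] W ε 0))
    [Finite (↥((W.selmerInfty κ ⊓
          ⨅ σ : Field.absoluteGaloisGroup ℚ,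
            (localKummerOverOfEmb W p κ.kerSubgroup (closureEmb (K := ℚ) ℚ_[p])
                (⨆ m, strictSignedLocalPoints κ ℚ_[p] W ε m)).comap (W.conjH1 p κ.kerSubgroup σ)).comap
          (W.layerToInfty κ 0)))] :
    padicValNat p (Nat.card (↥((W.selmerInfty κ ⊓
          ⨅ σ : Field.absoluteGaloisGroup ℚ,
            (localKummerOverOfEmb W p κ.kerSubgroup (closureEmb (K := ℚ) ℚ_[p])
                (⨆ m, strictSignedLocalPoints κ ℚ_[p] W ε m)).comap (W.conjH1 p κ.kerSubgroup σ)).comap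
          (W.layerToInfty κ 0)) ⧸
        (strictSignedSelmerLayer W κ ℚ_[p] ε 0).addSubgroupOf ((W.selmerInfty κ ⊓
          ⨅ σ : Field.absoluteGaloisGroup ℚ,
            (localKummerOverOfEmb W p κ.kerSubgroup (closureEmb (K := ℚ) ℚ_[p])
                (⨆ m, strictSignedLocalPoints κ ℚ_[p] W ε m)).comap (W.conjH1 p κ.kerSubgroup σ)).comap
          (W.layerToInfty κ 0)))) ≤
      ∑ v ∈ S.filter (fun v ↦ (p : 𝓞 ℚ) ∉ v.asIdeal),
        padicValNat p ((W.baseChange (v.adicCompletion ℚ)).localTamagawaNumber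
          (v.adicCompletionIntegers ℚ)) := by
  have hdvd := natCard_quotient_dvd_prod_natCard_localTowerKerPrimary_of_loc W κ ε S hS hloc
  rw [prod_natCard_localTowerKerPrimary_eq_prod_pow W hκ S, Finset.prod_pow_eq_pow_sum] at hdvd
  have hne : p ^ ∑ v ∈ S.filter (fun v ↦ (p : 𝓞 ℚ) ∉ v.asIdeal),
      padicValNat p ((W.baseChange (v.adicCompletion ℚ)).localTamagawaNumber
        (v.adicCompletionIntegers ℚ)) ≠ 0 := pow_ne_zero _ hp.out.ne_zero
  have h := (Nat.pow_dvd_pow_iff_le_right hp.out.one_lt).mp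
    ((pow_padicValNat_dvd).trans hdvd)
  exact h

end Tamagawa

end StrictSignedControlZero

end Summit.BirchSwinnertonDyer.Rank1Residual.Additive

end
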